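import Summits.BirchSwinnertonDyer.Rank1Residual.AdditivePotMult.QuadraticBaseChangeDescentOverC
import HarnessLib

/-!
# The `p`-adic BSD DEFECT is ADDITIVE under the quadratic descent, model-free and WITHOUT MILNE:
# `δ_p(E_K; C) = δ_p(E) + δ_p(E^{(d_K)})` — whence the over-`K` input is NECESSARY AND SUFFICIENT and
# BOTH HALVES relocate exactly (row T-MIL-UNI, FILE U-5; seat n1011-p01 GEN 10)

HONEST FRAMING (cell `b2b-bsdres`, run/shared/lean/b2b/bsd-rank1-residual/, verbatim in every
file): the goal of the cell is to DELETE the COMBINATION-SHAPED residual classes of the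
Birch–Swinnerton-Dyer formula for ALL analytic-rank `≤ 1` elliptic curves over `ℚ` — "full BSD
formula for every rank `≤ 1` curve in class `C`" assembled STRICTLY from published theorems — so
that the rank-`≤ 1` remainder becomes exactly the CONSTRUCTION-SHAPED classes, which are TYPED
(missing-input `Prop`s), NOT attempted. This is not "finishing BSD". Sub-classes X3♯(M) / X4(M)
(additive, potentially multiplicative prime; base-change-and-descend): a RESEARCH ROUTE; they stay
CONSTRUCTION-SHAPED; nothing is booked by this file; no mark / label moved. THEOREMS ONLY: no
definition, no named fact, no `sorry`.

## What (row T-MIL-UNI, FILE U-5 — the one-sided / iff layer of additive-p1's `ModelFree.lean`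
## (`padicValRat_defectC_eq`, `missingPPartOverCAt_iff_bsdp`, `missingLowerBoundAt_iff_overC`,
## `missingUpperBoundAt_iff_overC`) WITHOUT the Weil-restriction binder `hWR`)

With `δ_p(X) := ord_p #Ш_an(X) − ord_p #Ш(X)` (for a rational value of `#Ш_an`), on the population of
FILE U-2 (`[K:ℚ] = 2`, `d_K` odd squarefree, `p ∣ d_K` odd, `W_d = C_d • W^{(d_K)}` globally minimal
multiplicative at `p`, H-4b's `hS`; `Ш(W)`, `Ш(W_d)` finite):

* `exists_unit_shaAnOverC_mul_eq` — **(★) with a `p`-adic unit, model-free, Milne-free**: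
  `#Ш_an(W⊗K)_C · #Ш(W) · #Ш(W_d) · r = #Ш_an(W) · #Ш_an(W_d) · #Ш(W_K)` for some `r ∈ ℚ_{>0}` with
  `v_p r = 0` (D-2's `shaAnOver_mul_eq_ordp` for the θ-model, fed by J-2's `hWR_p` from FILE U-1b's
  `hT`, and U-1b's `shaAnOver (C_θ • W_K) = ρ · shaAnOverC (W ⊗ K)`, `v_p ρ = 0`);
* `exists_shaAnOverC_eq_of_rat_noMilne` / `exists_shaAn_eq_of_overC_noMilne` — rationality up / down;
* **`padicValRat_defectC_baseChange_eq_add_noMilne`** — `δ_p(W⊗K; C) = δ_p(W) + δ_p(W_d)`;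
* `missingPPartOverCAt_baseChange_iff_bsdp_noMilne` — given `BSDp Wd p`:
  `MissingPPartOverCAt (W.baseChange K) p ↔ BSDp W p` (the over-`K` input is NECESSARY as well as
  sufficient — additive-p1's `missingPPartOverCAt_baseChange_iff_bsdp` minus `hMilneC`);
* `missingLowerBoundAt_iff_overC_noMilne`, `missingUpperBoundAt_iff_overC_noMilne` — the halves
  relocate exactly (given `BSDp Wd p`), Milne-free.

HONEST LIMITS: the population of FILE U-2; `Ш(W)`, `Ш(W_d)` finite as hypotheses (GZK in the class
twins); rational values of `#Ш_an` as hypotheses where needed; closes no class; moves no mark; 0 facts.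

References: T. Dokchitser, V. Dokchitser, Ann. of Math. 172 (2010) §1, §2.1
[DokchitserDokchitserAnnals2010]; J. S. Milne, Invent. Math. 17 (1972) §1 Thm. 1
[Milne1972ArithmeticAV]; R. L. Miller, LMS J. Comput. Math. 14 (2011) Def. 1.1 [Miller2011LMS].
-/

noncomputable section

open scoped Classical NumberField

open WeierstrassCurve NumberField IsDedekindDomain Rat.HeightOneSpectrum
  Literature.NumberTheory.EllipticCurves Literature.NumberTheory.EllipticCurves.Rank1Residual
  Literature.NumberTheory.EllipticCurves.Rank1Residual.Typed
  Literature.NumberTheory.DiophantineGeometry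

namespace Summit.BirchSwinnertonDyer.Rank1Residual.AdditivePotMult

section Defect

variable (W : WeierstrassCurve ℚ) [W.IsElliptic] [W.IsGloballyMinimal] (p : ℕ) [hp : Fact p.Prime]
  (K : Type) [Field K] [NumberField K]
  (Wd : WeierstrassCurve ℚ) [Wd.IsElliptic] [Wd.IsGloballyMinimal]

/-- **(★) WITH A `p`-ADIC UNIT, MODEL-FREE, MILNE-FREE.** On the population of FILE U-2 with `Ш(W)`,
`Ш(W_d)` finite: `∃ r ∈ ℚ_{>0}`, `v_p r = 0`, with
`shaAnOverC (W ⊗ K) · #Ш(W) · #Ш(W_d) · r = shaAn W · shaAn W_d · #Ш(W ⊗ K)` in `ℂ`. Proof: the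
θ-model `C_θ • W_K`; J-2's `hWR_p` for it (FILE U-1b's `hT`) and D-2's `shaAnOver_mul_eq_ordp` give
(★) with the unit `q`; U-1b's `shaAnOver_smul_baseChange_eq_mul_shaAnOverC` and U-1a's
`v_p C(W⊗K) = v_p ∏c + 1` turn `shaAnOver (C_θ • W_K)` into `ρ · shaAnOverC (W⊗K)`, `v_p ρ = 0`;
`r = ρ·q`; `#Ш` is a model invariant. [cite: Milne1972ArithmeticAV, §1 Thm. 1 and §2 (through DokchitserDokchitserAnnals2010, §2.1, proof of Thm. 8)]
[cite: DokchitserDokchitserAnnals2010, §1 Notation (arXiv pp. 4–5)] -/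
theorem exists_unit_shaAnOverC_mul_eq (hmod : hasEntireLFunction_rat) (h2 : Module.finrank ℚ K = 2)
    (hdodd : Odd (NumberField.discr K)) (hdsq : Squarefree (NumberField.discr K))
    (hpd : (p : ℤ) ∣ NumberField.discr K)
    {Cd : VariableChange ℚ} (hWd : Cd • W.quadraticTwist (NumberField.discr K : ℚ) = Wd)
    (hp2 : p ≠ 2) (hmult : Mult Wd p)
    (hS : ∀ v : HeightOneSpectrum (𝓞 ℚ), W.HasGoodReductionAt v ∨ W.HasMultiplicativeReductionAt v ∨
      (((primesEquiv v : ℕ) : ℤ) ∣ NumberField.discr K ∧ Wd.HasMultiplicativeReductionAt v) ∨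
      (W.HasAdditiveReductionAt v ∧ ¬ ((primesEquiv v : ℕ) : ℤ) ∣ NumberField.discr K ∧
        (p = 3 → (primesEquiv v : ℕ) ≠ 3)))
    (hfinW : W.ShaFinite) (hfinD : Wd.ShaFinite) :
    ∃ r : ℚ, 0 < r ∧ padicValRat p r = 0 ∧
      shaAnOverC (W.baseChange K) * (W.shaOrder : ℂ) * (Wd.shaOrder : ℂ) * (r : ℂ) =
        shaAn W * shaAn Wd * ((W.baseChange K).shaOrder : ℂ) := by
  haveI : Finite W.sha := hfinW
  haveI : Finite Wd.sha := hfinD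
  haveI : (W.baseChange K).IsElliptic := by rw [baseChange]; infer_instance
  -- the θ-model and Milne's binder for it
  obtain ⟨θ, hθ0, hθ⟩ := exists_sq_eq_discr h2
  set C' : VariableChange K := ⟨Units.mk0 θ hθ0, 0, 0, 0⟩ with hC'
  have hu : (C'.u : K) = θ := by rw [hC']; exact Units.val_mk0 hθ0
  have hθ' : (C'.u : K) ^ 2 = algebraMap ℚ K (NumberField.discr K : ℚ) := by rw [hu]; exact hθ
  have hT :=
    padicValRat_norm_theta_mul_tamagawaProduct_eq_of_addv_unramified_oddPrime_of_dvd_discr W K Wd p h2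
      hdodd hdsq hpd hWd hp2 hmult hS hθ'
  obtain ⟨q, hq0, hqv, hWR⟩ := milneQuotient_ordp_of_tamagawa_anyRank W K Wd (C' • W.baseChange K) h2
    hWd (C' := C') rfl p hp2 hT
  have hshaK : (C' • W.baseChange K).ShaFinite :=
    shaFinite_baseChange_quadratic W K Wd (C' • W.baseChange K) h2 ⟨Cd, hWd⟩ ⟨C', rfl⟩ hfinW hfinD
  have hstar := shaAnOver_mul_eq_ordp W K Wd (C' • W.baseChange K) hmod h2 ⟨Cd, hWd⟩ ⟨C', rfl⟩
    hfinW hfinD hshaK hq0 hWR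
  -- the bridge `shaAnOver (C' • W_K) = ρ · shaAnOverC (W_K)`, `v_p ρ = 0`
  set VK := W.baseChange K with hVK
  set ρ : ℚ := VK.modifiedTamagawaProduct / (|Algebra.norm ℚ (C'.u : K)| * VK.tamagawaProduct)
    with hρ_def
  have hmain : shaAnOver (C' • VK) = (ρ : ℂ) * shaAnOverC VK :=
    shaAnOver_smul_baseChange_eq_mul_shaAnOverC W C'
  have hρ0 : 0 < ρ := modifiedTamagawaProduct_div_norm_mul_tamagawaProduct_pos W C'
  have hρv : padicValRat p ρ = 0 :=
    padicValRat_modifiedTamagawaProduct_div_norm_theta_eq_zero W Wd h2 hdsq p hp2 hpd hWd hmult hθ'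
  have hsha : (C' • VK).shaOrder = VK.shaOrder := shaOrder_variableChange_holds VK C'
  refine ⟨ρ * q, mul_pos hρ0 hq0, by rw [padicValRat.mul hρ0.ne' hq0.ne', hρv, hqv, add_zero], ?_⟩
  rw [hmain, hsha] at hstar
  push_cast
  linear_combination hstar

/-- **Rationality transfers UP, Milne-free**: rational values `q`, `q_d` of `#Ш_an(W)`, `#Ш_an(W_d)`
give the rational value `q·q_d·#Ш(W⊗K)/(#Ш(W)·#Ш(W_d)·r)` of `#Ш_an(W⊗K)_C` (`r` the unit of (★)).
[cite: DokchitserDokchitserAnnals2010, §2.1] -/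
theorem exists_shaAnOverC_eq_of_rat_noMilne (hmod : hasEntireLFunction_rat)
    (h2 : Module.finrank ℚ K = 2)
    (hdodd : Odd (NumberField.discr K)) (hdsq : Squarefree (NumberField.discr K))
    (hpd : (p : ℤ) ∣ NumberField.discr K)
    {Cd : VariableChange ℚ} (hWd : Cd • W.quadraticTwist (NumberField.discr K : ℚ) = Wd)
    (hp2 : p ≠ 2) (hmult : Mult Wd p)
    (hS : ∀ v : HeightOneSpectrum (𝓞 ℚ), W.HasGoodReductionAt v ∨ W.HasMultiplicativeReductionAt v ∨
      (((primesEquiv v : ℕ) : ℤ) ∣ NumberField.discr K ∧ Wd.HasMultiplicativeReductionAt v) ∨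
      (W.HasAdditiveReductionAt v ∧ ¬ ((primesEquiv v : ℕ) : ℤ) ∣ NumberField.discr K ∧
        (p = 3 → (primesEquiv v : ℕ) ≠ 3)))
    (hfinW : W.ShaFinite) (hfinD : Wd.ShaFinite)
    {q qd : ℚ} (hq : shaAn W = (q : ℂ)) (hqd : shaAn Wd = (qd : ℂ)) :
    ∃ q' : ℚ, shaAnOverC (W.baseChange K) = (q' : ℂ) ∧
      padicValRat p q' - padicValNat p (W.baseChange K).shaOrder =
        (padicValRat p q - padicValNat p W.shaOrder) +
          (padicValRat p qd - padicValNat p Wd.shaOrder) := by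
  haveI : (W.baseChange K).IsElliptic := by rw [baseChange]; infer_instance
  obtain ⟨r, hr0, hrv, hstar⟩ := exists_unit_shaAnOverC_mul_eq W p K Wd hmod h2 hdodd hdsq hpd hWd
    hp2 hmult hS hfinW hfinD
  have hshaK : (W.baseChange K).ShaFinite :=
    shaFinite_baseChange_quadratic W K Wd (W.baseChange K) h2 ⟨Cd, hWd⟩ ⟨1, one_smul _ _⟩ hfinW hfinD
  have hsW : W.shaOrder ≠ 0 := (W.shaOrder_pos hfinW).ne'
  have hsD : Wd.shaOrder ≠ 0 := (Wd.shaOrder_pos hfinD).ne'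
  have hsK : (W.baseChange K).shaOrder ≠ 0 := ((W.baseChange K).shaOrder_pos hshaK).ne'
  have hq0 : q ≠ 0 := by
    intro h0; apply shaAn_ne_zero W hmod; rw [hq, h0, Rat.cast_zero]
  have hqd0 : qd ≠ 0 := by
    intro h0; apply shaAn_ne_zero Wd hmod; rw [hqd, h0, Rat.cast_zero]
  set q' : ℚ := q * qd * (W.baseChange K).shaOrder / (W.shaOrder * Wd.shaOrder * r) with hq'_def
  have hq' : shaAnOverC (W.baseChange K) = (q' : ℂ) := by
    have hden : (W.shaOrder : ℂ) * (Wd.shaOrder : ℂ) * (r : ℂ) ≠ 0 :=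
      mul_ne_zero (mul_ne_zero (by exact_mod_cast hsW) (by exact_mod_cast hsD))
        (by exact_mod_cast hr0.ne')
    rw [hq'_def]
    push_cast
    rw [eq_div_iff hden, ← hq, ← hqd]
    linear_combination hstar
  refine ⟨q', hq', ?_⟩
  have hsWq : (W.shaOrder : ℚ) ≠ 0 := by exact_mod_cast hsW
  have hsDq : (Wd.shaOrder : ℚ) ≠ 0 := by exact_mod_cast hsD
  have hsKq : ((W.baseChange K).shaOrder : ℚ) ≠ 0 := by exact_mod_cast hsK
  rw [hq'_def, padicValRat.div (mul_ne_zero (mul_ne_zero hq0 hqd0) hsKq)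
      (mul_ne_zero (mul_ne_zero hsWq hsDq) hr0.ne'),
    padicValRat.mul (mul_ne_zero hq0 hqd0) hsKq, padicValRat.mul hq0 hqd0,
    padicValRat.mul (mul_ne_zero hsWq hsDq) hr0.ne', padicValRat.mul hsWq hsDq, hrv,
    padicValRat.of_nat, padicValRat.of_nat, padicValRat.of_nat]
  ring

/-- **THE `p`-ADIC BSD DEFECT IS ADDITIVE UNDER THE QUADRATIC DESCENT, MODEL-FREE, MILNE-FREE.** On
the population of FILE U-2 with `Ш(W)`, `Ш(W_d)` finite, for rational values `#Ш_an(W) = q`,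
`#Ш_an(W_d) = q_d`, `#Ш_an(W⊗K)_C = q'`:
**`(ord_p q' − ord_p #Ш(W⊗K)) = (ord_p q − ord_p #Ш(W)) + (ord_p q_d − ord_p #Ш(W_d))`.**
(★) with the unit `r` read in `ℚ` with every factor non-zero. Additive-p1's
`ModelFree.padicValRat_defectC_eq` is the special case `δ_p(W_d) = 0` WITH Milne's `hWR`.
[cite: Milne1972ArithmeticAV, §1 Thm. 1 and §2 (through DokchitserDokchitserAnnals2010, §2.1, proof of Thm. 8)]
[cite: Miller2011LMS, Def. 1.1 (arXiv:1010.2431 p. 3)] -/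
theorem padicValRat_defectC_baseChange_eq_add_noMilne (hmod : hasEntireLFunction_rat)
    (h2 : Module.finrank ℚ K = 2)
    (hdodd : Odd (NumberField.discr K)) (hdsq : Squarefree (NumberField.discr K))
    (hpd : (p : ℤ) ∣ NumberField.discr K)
    {Cd : VariableChange ℚ} (hWd : Cd • W.quadraticTwist (NumberField.discr K : ℚ) = Wd)
    (hp2 : p ≠ 2) (hmult : Mult Wd p)
    (hS : ∀ v : HeightOneSpectrum (𝓞 ℚ), W.HasGoodReductionAt v ∨ W.HasMultiplicativeReductionAt v ∨
      (((primesEquiv v : ℕ) : ℤ) ∣ NumberField.discr K ∧ Wd.HasMultiplicativeReductionAt v) ∨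
      (W.HasAdditiveReductionAt v ∧ ¬ ((primesEquiv v : ℕ) : ℤ) ∣ NumberField.discr K ∧
        (p = 3 → (primesEquiv v : ℕ) ≠ 3)))
    (hfinW : W.ShaFinite) (hfinD : Wd.ShaFinite)
    {q qd q' : ℚ} (hq : shaAn W = (q : ℂ)) (hqd : shaAn Wd = (qd : ℂ))
    (hq' : shaAnOverC (W.baseChange K) = (q' : ℂ)) :
    padicValRat p q' - padicValNat p (W.baseChange K).shaOrder =
      (padicValRat p q - padicValNat p W.shaOrder) +
        (padicValRat p qd - padicValNat p Wd.shaOrder) := by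
  obtain ⟨q'', hq'', hdef⟩ := exists_shaAnOverC_eq_of_rat_noMilne W p K Wd hmod h2 hdodd hdsq hpd hWd
    hp2 hmult hS hfinW hfinD hq hqd
  have heq : q' = q'' := by exact_mod_cast hq'.symm.trans hq''
  rw [heq]
  exact hdef

/-- **THE OVER-`K` INPUT IS NECESSARY AS WELL AS SUFFICIENT, WITHOUT MILNE**: on the population of
FILE U-2, given `BSD(W_d, p)`, `r_an(W) ≤ 1`, `r_an(W_d) ≤ 1`:
**`MissingPPartOverCAt (W.baseChange K) p ↔ BSDp W p`** (additive-p1's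
`missingPPartOverCAt_baseChange_iff_bsdp` with `hMilneC` REPLACED by the population hypotheses).
[cite: Milne1972ArithmeticAV, §1 Thm. 1 and §2 (through DokchitserDokchitserAnnals2010, §2.1, proof of Thm. 8)]
[cite: Miller2011LMS, Def. 1.1 (arXiv:1010.2431 p. 3)] -/
theorem missingPPartOverCAt_baseChange_iff_bsdp_noMilne
    (hGZK : rank_eq_analyticRank_of_analyticRank_le_one) (hmod : hasEntireLFunction_rat)
    (h2 : Module.finrank ℚ K = 2)
    (hdodd : Odd (NumberField.discr K)) (hdsq : Squarefree (NumberField.discr K))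
    (hpd : (p : ℤ) ∣ NumberField.discr K)
    {Cd : VariableChange ℚ} (hWd : Cd • W.quadraticTwist (NumberField.discr K : ℚ) = Wd)
    (hr : W.analyticRank ≤ 1) (hrd : Wd.analyticRank ≤ 1) (hp2 : p ≠ 2) (hmult : Mult Wd p)
    (hS : ∀ v : HeightOneSpectrum (𝓞 ℚ), W.HasGoodReductionAt v ∨ W.HasMultiplicativeReductionAt v ∨
      (((primesEquiv v : ℕ) : ℤ) ∣ NumberField.discr K ∧ Wd.HasMultiplicativeReductionAt v) ∨
      (W.HasAdditiveReductionAt v ∧ ¬ ((primesEquiv v : ℕ) : ℤ) ∣ NumberField.discr K ∧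
        (p = 3 → (primesEquiv v : ℕ) ≠ 3)))
    (hd : BSDp Wd p) : MissingPPartOverCAt (W.baseChange K) p ↔ BSDp W p := by
  refine ⟨fun hK =>
    bsdp_of_pPartOverC_baseChange_of_bsdp_twist_noMilne_of_addv_unramified_oddPrime_of_dvd_discr W p K
      Wd hGZK hmod h2 hdodd hdsq hpd hWd hr hrd hp2 hmult hS hK hd, fun hW => ?_⟩
  obtain ⟨-, hfinW⟩ := hGZK W hr
  obtain ⟨-, hfinD⟩ := hGZK Wd hrd
  haveI : Finite W.sha := hfinW
  haveI : Finite Wd.sha := hfinD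
  obtain ⟨q, hq, hv⟩ := missingPPartAt_of_bsdp W p hW
  obtain ⟨qd, hqd, hvd⟩ := missingPPartAt_of_bsdp Wd p hd
  obtain ⟨q', hq', hdef⟩ := exists_shaAnOverC_eq_of_rat_noMilne W p K Wd hmod h2 hdodd hdsq hpd hWd hp2
    hmult hS hfinW hfinD hq hqd
  refine ⟨q', hq', ?_⟩
  linarith

/-- **LOWER HALF over `ℚ` ⟺ LOWER HALF on `W ⊗ K` (model-free), WITHOUT MILNE**, given `BSD(W_d,p)`,
`Ш(W)`, `Ш(W_d)` finite (additive-p1's `missingLowerBoundAt_iff_overC` minus `hWR`).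
[cite: Milne1972ArithmeticAV, §1 Thm. 1 and §2 (through DokchitserDokchitserAnnals2010, §2.1, proof of Thm. 8)] -/
theorem missingLowerBoundAt_iff_overC_noMilne (hmod : hasEntireLFunction_rat)
    (h2 : Module.finrank ℚ K = 2)
    (hdodd : Odd (NumberField.discr K)) (hdsq : Squarefree (NumberField.discr K))
    (hpd : (p : ℤ) ∣ NumberField.discr K)
    {Cd : VariableChange ℚ} (hWd : Cd • W.quadraticTwist (NumberField.discr K : ℚ) = Wd)
    (hp2 : p ≠ 2) (hmult : Mult Wd p)
    (hS : ∀ v : HeightOneSpectrum (𝓞 ℚ), W.HasGoodReductionAt v ∨ W.HasMultiplicativeReductionAt v ∨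
      (((primesEquiv v : ℕ) : ℤ) ∣ NumberField.discr K ∧ Wd.HasMultiplicativeReductionAt v) ∨
      (W.HasAdditiveReductionAt v ∧ ¬ ((primesEquiv v : ℕ) : ℤ) ∣ NumberField.discr K ∧
        (p = 3 → (primesEquiv v : ℕ) ≠ 3)))
    (hfinW : W.ShaFinite) (hfinD : Wd.ShaFinite) (hd : BSDp Wd p) :
    MissingLowerBoundAt W p ↔ MissingLowerBoundOverCAt (W.baseChange K) p := by
  haveI : Finite Wd.sha := hfinD
  obtain ⟨qd, hqd, hvd⟩ := missingPPartAt_of_bsdp Wd p hd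
  obtain ⟨r, hr0, hrv, hstar⟩ := exists_unit_shaAnOverC_mul_eq W p K Wd hmod h2 hdodd hdsq hpd hWd
    hp2 hmult hS hfinW hfinD
  haveI : (W.baseChange K).IsElliptic := by rw [baseChange]; infer_instance
  have hshaK : (W.baseChange K).ShaFinite :=
    shaFinite_baseChange_quadratic W K Wd (W.baseChange K) h2 ⟨Cd, hWd⟩ ⟨1, one_smul _ _⟩ hfinW hfinD
  have hsK : (W.baseChange K).shaOrder ≠ 0 := ((W.baseChange K).shaOrder_pos hshaK).ne'
  have hqd0 : (qd : ℂ) ≠ 0 := by rw [← hqd]; exact shaAn_ne_zero Wd hmod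
  constructor
  · rintro ⟨q, hq, hle⟩
    obtain ⟨q', hq', hdef⟩ := exists_shaAnOverC_eq_of_rat_noMilne W p K Wd hmod h2 hdodd hdsq hpd hWd
      hp2 hmult hS hfinW hfinD hq hqd
    refine ⟨q', hq', ?_⟩
    linarith
  · rintro ⟨q', hq', hle⟩
    -- rationality down: `#Ш_an(W) = q'·#Ш(W)·#Ш(W_d)·r/(q_d·#Ш(W⊗K))`
    set q : ℚ := q' * W.shaOrder * Wd.shaOrder * r / (qd * (W.baseChange K).shaOrder) with hq_def
    have hq : shaAn W = (q : ℂ) := by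
      have hden : (qd : ℂ) * ((W.baseChange K).shaOrder : ℂ) ≠ 0 :=
        mul_ne_zero hqd0 (by exact_mod_cast hsK)
      rw [hq_def]
      push_cast
      rw [eq_div_iff hden, ← hqd, ← hq']
      linear_combination -hstar
    refine ⟨q, hq, ?_⟩
    have hdef := padicValRat_defectC_baseChange_eq_add_noMilne W p K Wd hmod h2 hdodd hdsq hpd hWd hp2
      hmult hS hfinW hfinD hq hqd hq'
    linarith

/-- **UPPER HALF over `ℚ` ⟺ UPPER HALF on `W ⊗ K` (model-free), WITHOUT MILNE**, given `BSD(W_d,p)`,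
`Ш(W)`, `Ш(W_d)` finite (additive-p1's `missingUpperBoundAt_iff_overC` minus `hWR`).
[cite: Milne1972ArithmeticAV, §1 Thm. 1 and §2 (through DokchitserDokchitserAnnals2010, §2.1, proof of Thm. 8)] -/
theorem missingUpperBoundAt_iff_overC_noMilne (hmod : hasEntireLFunction_rat)
    (h2 : Module.finrank ℚ K = 2)
    (hdodd : Odd (NumberField.discr K)) (hdsq : Squarefree (NumberField.discr K))
    (hpd : (p : ℤ) ∣ NumberField.discr K)
    {Cd : VariableChange ℚ} (hWd : Cd • W.quadraticTwist (NumberField.discr K : ℚ) = Wd)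
    (hp2 : p ≠ 2) (hmult : Mult Wd p)
    (hS : ∀ v : HeightOneSpectrum (𝓞 ℚ), W.HasGoodReductionAt v ∨ W.HasMultiplicativeReductionAt v ∨
      (((primesEquiv v : ℕ) : ℤ) ∣ NumberField.discr K ∧ Wd.HasMultiplicativeReductionAt v) ∨
      (W.HasAdditiveReductionAt v ∧ ¬ ((primesEquiv v : ℕ) : ℤ) ∣ NumberField.discr K ∧
        (p = 3 → (primesEquiv v : ℕ) ≠ 3)))
    (hfinW : W.ShaFinite) (hfinD : Wd.ShaFinite) (hd : BSDp Wd p) :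
    MissingUpperBoundAt W p ↔ MissingUpperBoundOverCAt (W.baseChange K) p := by
  haveI : Finite Wd.sha := hfinD
  obtain ⟨qd, hqd, hvd⟩ := missingPPartAt_of_bsdp Wd p hd
  obtain ⟨r, hr0, hrv, hstar⟩ := exists_unit_shaAnOverC_mul_eq W p K Wd hmod h2 hdodd hdsq hpd hWd
    hp2 hmult hS hfinW hfinD
  haveI : (W.baseChange K).IsElliptic := by rw [baseChange]; infer_instance
  have hshaK : (W.baseChange K).ShaFinite :=
    shaFinite_baseChange_quadratic W K Wd (W.baseChange K) h2 ⟨Cd, hWd⟩ ⟨1, one_smul _ _⟩ hfinW hfinD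
  have hsK : (W.baseChange K).shaOrder ≠ 0 := ((W.baseChange K).shaOrder_pos hshaK).ne'
  have hqd0 : (qd : ℂ) ≠ 0 := by rw [← hqd]; exact shaAn_ne_zero Wd hmod
  constructor
  · rintro ⟨q, hq, hle⟩
    obtain ⟨q', hq', hdef⟩ := exists_shaAnOverC_eq_of_rat_noMilne W p K Wd hmod h2 hdodd hdsq hpd hWd
      hp2 hmult hS hfinW hfinD hq hqd
    refine ⟨q', hq', ?_⟩
    linarith
  · rintro ⟨q', hq', hle⟩
    set q : ℚ := q' * W.shaOrder * Wd.shaOrder * r / (qd * (W.baseChange K).shaOrder) with hq_def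
    have hq : shaAn W = (q : ℂ) := by
      have hden : (qd : ℂ) * ((W.baseChange K).shaOrder : ℂ) ≠ 0 :=
        mul_ne_zero hqd0 (by exact_mod_cast hsK)
      rw [hq_def]
      push_cast
      rw [eq_div_iff hden, ← hqd, ← hq']
      linear_combination -hstar
    refine ⟨q, hq, ?_⟩
    have hdef := padicValRat_defectC_baseChange_eq_add_noMilne W p K Wd hmod h2 hdodd hdsq hpd hWd hp2
      hmult hS hfinW hfinD hq hqd hq'
    linarith

end Defect

end Summit.BirchSwinnertonDyer.Rank1Residual.AdditivePotMult

end
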